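import Summits.QuantumFields.YangMills.Theorems.UnitScaleTiltHistoryTailLaneTailInt
import HarnessLib

/-!
# Route `UnitScaleTilt` — crux K2-L `HistoryTailL` (stmt-QuantumFields-19936): CROSS-CHECK — THE OLD (α) RECORD ALSO INSTANTIATES THE RECORD-FREE INTERIOR SOCKET
# (`AlphaInputsT3ACv3Rec L → AlphaInputsT3AC.IntCoreRec L`), so the core-family engine `…LaneTailInt.historyTailL_of_intCoreRec` re-proves v5p8's closer
# `HistoryTailLaneTail.historyTailL_of_laneRecords` through the data cores `(pkgAtV3 …).toCore` — seat ym3-torus-p2 (g16); `--supports` 19936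

WHY.  The old package's lower row is (47)′ with the TOWER's characteristic function `χ_j = chiSmall univ (θBal(K−j))` (`PkgAtV3.le_resDensity_ae`); the interior indicator
`𝟙[PlaqSmall (θBal(K−j)/max(B₃,1))]` is pointwise BELOW it, so the interior datum's `Ineq47AE` follows a.e. — the interior socket is weaker than both records' lower rows, as it
should be.  Nothing of [Balaban1985UV3] is asserted (the old record `OfV3At` is an OPEN hypothesis, retired from the live DAG by R-57χ; this file is a consistency check only).
[cite: Balaban1985UV3, (47) p.267 and Thm 2 p.272; Balaban1985Variational, Thm 1 (8) p.279]
-/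

set_option autoImplicit false

noncomputable section

open MeasureTheory
open Literature.MathematicalPhysics.QuantumFieldTheory.Balaban1983to89
open Literature.MathematicalPhysics.QuantumFieldTheory.Balaban1983to89.T3ContinuumYM3Torus
open Literature.MathematicalPhysics.QuantumFieldTheory.Balaban1983to89.T3UnitScaleTilt (θBal)
open Literature.MathematicalPhysics.QuantumFieldTheory.Balaban1983to89.T3AlphaInputsAC
open Summit.QuantumFields.Balaban3D.Carriers (suGroupModel Hist)
open Summit.QuantumFields.Balaban3D.Proofs.Primitives (AlphaConsts)
open Summit.QuantumFields.YangMills.Theorems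

namespace Summit.QuantumFields.YangMills.Theorems.HistoryTailLaneTailOldRec

/-- **THE INTERIOR (47)′ ROW FROM THE OLD PACKAGE'S TOWER-χ ROW**: for an old package `p : PkgAtV3 F 𝔠 γ hγ hγ1 K` placed at height `K` of a family of data cores with
`qf K = p.toCore`, the interior datum satisfies `Ineq47AE` at every `j ≤ K` — `𝟙[PlaqSmall (θBal/max(B₃,1))] ≤ chiSmall univ θBal` pointwise and `PkgAtV3.le_resDensity_ae`.
[cite: Balaban1985UV3, (47) p.267 and Thm 2 p.272] -/
theorem dataIntV3_ineq47AE_of_pkgAtV3 {F : T3Family} {𝔠 : AlphaConsts F.L (suGroupModel 2).N} {γ : ℝ} {hγ : 0 < γ} {hγ1 : γ ≤ (min 𝔠.gamma0 1) ^ 2}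
    (qf : ∀ K, AlphaInputsT3AC.PkgCoreV3 F 𝔠 γ hγ hγ1 K) (π : AlphaInputsT3AC.PolymerT3 F) (K : ℕ)
    (p : AlphaInputsT3AC.PkgAtV3 F 𝔠 γ hγ hγ1 K) (hp : qf K = p.toCore) (j : ℕ) (hj : j ≤ K) :
    Ineq47AE (AlphaInputsT3AC.dataIntV3 qf π) K j := by
  have h := p.le_resDensity_ae j hj
  have hε : (Summit.QuantumFields.Balaban3D.Proofs.InputsAC.inputOfAC 𝔠.lane p.X p.𝔖).ε₁ j = θBal F.L γ 𝔠.b₀ 𝔠.p₀ (K - j) := p.eps1_eq j hj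
  have hχ : ∀ W : GaugeField (F.P K) j (Matrix.specialUnitaryGroup (Fin 2) ℂ), p.T.χ j W = chiSmall Set.univ (θBal F.L γ 𝔠.b₀ 𝔠.p₀ (K - j)) W := fun W => by
    rw [← hε]; rfl
  have hB1 : 1 ≤ max 𝔠.B₃ 1 := le_max_right _ _
  have hθ : 0 < θBal F.L γ 𝔠.b₀ 𝔠.p₀ (K - j) := p.θBal_pos j hj
  -- the interior indicator is below the tower's characteristic function
  have hind : ∀ W : GaugeField (F.P K) j (Matrix.specialUnitaryGroup (Fin 2) ℂ),
      {V : GaugeField (F.P K) j (Matrix.specialUnitaryGroup (Fin 2) ℂ) |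
          PlaqSmall (θBal F.L γ 𝔠.b₀ 𝔠.p₀ (K - j) / max 𝔠.B₃ 1) V}.indicator (fun _ => (1 : ℝ)) W ≤ p.T.χ j W := by
    intro W
    rw [hχ W]
    by_cases hW : W ∈ {V : GaugeField (F.P K) j (Matrix.specialUnitaryGroup (Fin 2) ℂ) |
        PlaqSmall (θBal F.L γ 𝔠.b₀ 𝔠.p₀ (K - j) / max 𝔠.B₃ 1) V}
    · rw [Set.indicator_of_mem hW]
      have hWθ : PlaqSmallOn Set.univ (θBal F.L γ 𝔠.b₀ 𝔠.p₀ (K - j)) W :=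
        fun q _ => (hW q).trans_le (div_le_self hθ.le hB1)
      unfold chiSmall
      rw [if_pos hWθ]
    · rw [Set.indicator_of_notMem hW]
      unfold chiSmall
      split_ifs <;> norm_num
  show ∀ᵐ W ∂fieldMeasure (F.P K) j (Matrix.specialUnitaryGroup (Fin 2) ℂ),
    Real.exp (-((qf K).T.Ecst j - (qf K).E) - (qf K).T.Rm j) *
        ({V : GaugeField (F.P K) j (Matrix.specialUnitaryGroup (Fin 2) ℂ) |
            PlaqSmall (θBal F.L γ 𝔠.b₀ 𝔠.p₀ (K - j) / max 𝔠.B₃ 1) V}.indicator (fun _ => (1 : ℝ)) W *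
          Real.exp (-((qf K).T.mainT j (Hist.triv (F.P K) j) W) + (qf K).T.Pint j (Hist.triv (F.P K) j) W)) ≤
      T3RestrictedUnitDensity.resDensity F γ K Set.univ j W
  rw [hp]
  filter_upwards [h] with W hW
  refine le_trans (mul_le_mul_of_nonneg_left (mul_le_mul_of_nonneg_right (hind W) (Real.exp_pos _).le) (Real.exp_pos _).le) ?_
  exact hW

/-- **THE OLD RECORD INSTANTIATES THE RECORD-FREE INTERIOR SOCKET**: `AlphaInputsT3ACv3Rec L → AlphaInputsT3AC.IntCoreRec L` — data cores `(h.pkgAtV3 …).toCore`, constant `a₁` by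
`pkgAtV3_a₁`, interior (47)′ by `dataIntV3_ineq47AE_of_pkgAtV3` (no threshold needed; the binder `θBal ≤ a₁` is idle here). Hence `…LaneTailInt.historyTailL_of_intCoreRec` also
re-derives v5p8's `historyTailL_of_laneRecords`. [cite: Balaban1985UV3, (47) p.267 and Thm 2 p.272; Balaban1985Variational, Thm 1 (8) p.279] -/
theorem intCoreRec_of_laneRecords (L : ℕ) (h : Summit.QuantumFields.YangMills.Theorems.AlphaInputsT3ACv3Rec L) :
    AlphaInputsT3AC.IntCoreRec L := by
  obtain ⟨b₁, p₁, h⟩ := h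
  refine ⟨b₁, p₁, fun b₀ p₀ hb hp => ?_⟩
  obtain ⟨𝔠, a₀, a₁, hcb, hcp, ha0, ha1, hw, hF⟩ := h b₀ p₀ hb hp
  refine ⟨𝔠, a₁, hcb, hcp, ha1, fun F hFL γ hγ hγ1 => ?_⟩
  subst hFL
  have hrec : AlphaInputsT3AC.OfV3At F 𝔠 a₀ a₁ := hF F rfl
  have hc : 0 < a₀ ∧ 0 < a₁ ∧ 𝔠.B₃ * a₁ ≤ a₀ := ⟨ha0, ha1, hw⟩
  refine ⟨fun K => (hrec.pkgAtV3 hc γ hγ hγ1 K).toCore, fun K => hrec.pkgAtV3_a₁ hc γ hγ hγ1 K, fun _ π K j hj => ?_⟩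
  exact dataIntV3_ineq47AE_of_pkgAtV3 _ π K (hrec.pkgAtV3 hc γ hγ hγ1 K) rfl j hj

end Summit.QuantumFields.YangMills.Theorems.HistoryTailLaneTailOldRec

end
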